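import Summits.ABC.ABC.Theses.IneffectiveSubspace

/-!
# Stub `stub_base` of line `Sketch` — crux `IneffectiveSubspace.DepthCountedABC` (stmt-ABC-14938)

THE BASE TRANSFER `S4SmallMemberABC → SmallFullSizeFiveFree`.

* Hypothesis (`S4SmallMemberABC`): abc with the member `a` charged at full size and `b, c` charged
  through the level-4 radical `S₄(n) := ∏_{p ∣ n} p^⌈v_p(n)/4⌉ = ∏ p ∈ n.primeFactors, p ^ ((v_p(n)+3)/4)`:
  for every `ε > 0` a constant `C` with `c ≤ C · a · (S₄(b)·S₄(c))^(1+ε)` on every abc triple.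
* Conclusion (the T-statement on the 5-FREE cell `ω₅(abc) = #{p : v_p(abc) ≥ 5} = 0`): for every
  `δ > 0` a constant `C` with `c < C · (a · rad(bc))^(1+δ)` on every 5-free abc triple.

Proof. Given `δ` take `C` from the hypothesis at `ε := δ` and output `C + 1`.  On a 5-free triple
every prime of `abc` has exponent `≤ 4`, so for `p ∣ b` we get `1 ≤ v_p(b) ≤ v_p(abc) ≤ 4`, hence
`⌈v_p(b)/4⌉ = 1` and `S₄(b) = ∏_{p ∣ b} p = rad b`; likewise `S₄(c) = rad c`.  As `gcd(b, c) = 1`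
(from `a + b = c`, `gcd(a, b) = 1`), `rad b · rad c = rad(bc)`.  So `c ≤ C · a · rad(bc)^(1+δ)`, and
`a ≤ a^(1+δ)` (`a ≥ 1`) gives `c ≤ C · (a · rad(bc))^(1+δ) < (C+1) · (a · rad(bc))^(1+δ)`.

Sources: skeleton `Cruxes/DepthCountedABC/Lines/Sketch.lean` of lead `prover-line-stmt-ABC-14938-0`
(stub 3, `stub_base`).  Mathlib only (`Nat.radical_eq_prod_primeFactors`,
`UniqueFactorizationMonoid.radical_mul`, `Nat.coprime_iff_isRelPrime`, `Nat.factorization_le_iff_dvd`,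
`Nat.primeFactors_mono`, `Real.mul_rpow`, `Real.self_le_rpow_of_one_le`, `Real.rpow_pos_of_pos`).
Deliberately NOT here: the dictionary `LW4 → S4SmallMemberABC`, the deep cells `1 ≤ ω₅ ≤ K`, the
power-rich residual and the assembly (the other stubs of the line).
-/

-- `Summit.<Summit>.<Problem>` is the mandated summit-side namespace (CONVENTIONS §2); for the
-- single-conjunct summit `ABC` the two coincide, so the duplicate `ABC.ABC` is deliberate.
set_option linter.dupNamespace false

namespace Summit.ABC.ABC.Theorems.DepthCountedABC

open scoped BigOperators

/-- On a number `x` all of whose prime exponents are at most `4`, the level-4 radical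
`S₄(x) = ∏_{p ∣ x} p^⌈v_p(x)/4⌉` is the radical `rad x = ∏_{p ∣ x} p`. [folklore] -/
theorem stubBase_S4_eq_radical {x : ℕ} (hx : ∀ p ∈ x.primeFactors, x.factorization p ≤ 4) :
    (∏ p ∈ x.primeFactors, p ^ ((x.factorization p + 3) / 4)) =
      UniqueFactorizationMonoid.radical x := by
  rw [Nat.radical_eq_prod_primeFactors]
  refine Finset.prod_congr rfl (fun p hp => ?_)
  obtain ⟨hpp, hpx, hx0⟩ := Nat.mem_primeFactors.mp hp
  have h1 : 0 < x.factorization p := hpp.factorization_pos_of_dvd hx0 hpx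
  have h4 : x.factorization p ≤ 4 := hx p hp
  have h : (x.factorization p + 3) / 4 = 1 := by omega
  rw [h, pow_one]

/-- A factor `x ∣ n` of a 5-free number `n ≠ 0` (every prime exponent of `n` is `≤ 4`) is itself
5-free. [folklore] -/
theorem stubBase_factor_fiveFree {x n : ℕ} (hn : n ≠ 0) (hdvd : x ∣ n)
    (h4 : ∀ p ∈ n.primeFactors, n.factorization p ≤ 4) :
    ∀ p ∈ x.primeFactors, x.factorization p ≤ 4 := by
  -- adapted from `Cruxes/DepthCountedABC/SketchIdeator2.lean` (`mem_deep_of_factor`)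
  intro p hp
  have hx0 : x ≠ 0 := by rintro rfl; exact hn (zero_dvd_iff.mp hdvd)
  exact le_trans ((Nat.factorization_le_iff_dvd hx0 hn).mpr hdvd p)
    (h4 p (Nat.primeFactors_mono hdvd hn hp))

/-- **Stub `stub_base` (BASE transfer) of line `Sketch`, crux `DepthCountedABC` (stmt-ABC-14938):**
`S4SmallMemberABC → SmallFullSizeFiveFree`, fully unfolded.  If for every `ε > 0` some `C > 0` gives
`c ≤ C · a · (S₄(b)·S₄(c))^(1+ε)` on all abc triples, then for every `δ > 0` some `C > 0` gives
`c < C · (a · rad(bc))^(1+δ)` on all abc triples with `#{p : v_p(abc) ≥ 5} = 0`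
(on such triples `S₄(b)·S₄(c) = rad b · rad c = rad(bc)` and `a ≤ a^(1+δ)`). [folklore] -/
theorem stub_base :
    (∀ ε : ℝ, 0 < ε → ∃ C : ℝ, 0 < C ∧ ∀ a b c : ℕ,
      Literature.NumberTheory.DiophantineGeometry.IsABCTriple a b c →
      (c : ℝ) ≤ C * (a : ℝ) *
        (((∏ p ∈ b.primeFactors, p ^ ((b.factorization p + 3) / 4)) *
          (∏ p ∈ c.primeFactors, p ^ ((c.factorization p + 3) / 4)) : ℕ) : ℝ) ^ (1 + ε)) →
    ∀ δ : ℝ, 0 < δ → ∃ C : ℝ, 0 < C ∧ ∀ a b c : ℕ,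
      Literature.NumberTheory.DiophantineGeometry.IsABCTriple a b c →
      ((a * b * c).primeFactors.filter (fun p => 5 ≤ (a * b * c).factorization p)).card = 0 →
      (c : ℝ) < C * ((a : ℝ) * ((UniqueFactorizationMonoid.radical (b * c) : ℕ) : ℝ)) ^ (1 + δ) := by
  intro hS δ hδ
  obtain ⟨C, hC, hh⟩ := hS δ hδ
  refine ⟨C + 1, by linarith, fun a b c habc h0 => ?_⟩
  have hineq := hh a b c habc
  obtain ⟨ha, hb, hsum, hcop⟩ := habc
  have hc : 0 < c := by omega
  have hne : a * b * c ≠ 0 := by positivity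
  -- the cell condition: every prime of `abc` has exponent `≤ 4`
  have h4 : ∀ p ∈ (a * b * c).primeFactors, (a * b * c).factorization p ≤ 4 := by
    intro p hp
    have hnot := Finset.filter_eq_empty_iff.mp (Finset.card_eq_zero.mp h0) hp
    omega
  -- `gcd(b, c) = 1`
  have hbc : Nat.Coprime b c := by
    rw [← hsum]; exact Nat.coprime_add_self_right.mpr hcop.symm
  have hdb : b ∣ a * b * c := dvd_mul_of_dvd_left (dvd_mul_left b a) c
  have hdc : c ∣ a * b * c := dvd_mul_left c (a * b)
  -- `S₄(b) · S₄(c) = rad b · rad c = rad(bc)`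
  have hprod : (∏ p ∈ b.primeFactors, p ^ ((b.factorization p + 3) / 4)) *
      (∏ p ∈ c.primeFactors, p ^ ((c.factorization p + 3) / 4)) =
        UniqueFactorizationMonoid.radical (b * c) := by
    rw [stubBase_S4_eq_radical (stubBase_factor_fiveFree hne hdb h4),
      stubBase_S4_eq_radical (stubBase_factor_fiveFree hne hdc h4),
      UniqueFactorizationMonoid.radical_mul (Nat.coprime_iff_isRelPrime.mp hbc)]
  rw [hprod] at hineq
  -- real bookkeeping: `C · a · R^(1+δ) ≤ C · (a R)^(1+δ) < (C+1) · (a R)^(1+δ)`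
  have hR0 : (0 : ℝ) < ((UniqueFactorizationMonoid.radical (b * c) : ℕ) : ℝ) := by
    exact_mod_cast Nat.radical_pos (b * c)
  have ha1 : (1 : ℝ) ≤ (a : ℝ) := by exact_mod_cast ha
  have ha0 : (0 : ℝ) ≤ (a : ℝ) := by linarith
  have hδ1 : (1 : ℝ) ≤ 1 + δ := by linarith
  have hapow : (a : ℝ) ≤ (a : ℝ) ^ (1 + δ) := Real.self_le_rpow_of_one_le ha1 hδ1
  have hRpow : (0 : ℝ) ≤ ((UniqueFactorizationMonoid.radical (b * c) : ℕ) : ℝ) ^ (1 + δ) :=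
    Real.rpow_nonneg hR0.le _
  have hmul : (a : ℝ) ^ (1 + δ) * ((UniqueFactorizationMonoid.radical (b * c) : ℕ) : ℝ) ^ (1 + δ) =
      ((a : ℝ) * ((UniqueFactorizationMonoid.radical (b * c) : ℕ) : ℝ)) ^ (1 + δ) :=
    (Real.mul_rpow ha0 hR0.le).symm
  have hpos : (0 : ℝ) < ((a : ℝ) * ((UniqueFactorizationMonoid.radical (b * c) : ℕ) : ℝ)) ^ (1 + δ) :=
    Real.rpow_pos_of_pos (mul_pos (by linarith) hR0) _
  calc (c : ℝ) ≤ C * (a : ℝ) * ((UniqueFactorizationMonoid.radical (b * c) : ℕ) : ℝ) ^ (1 + δ) := hineq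
    _ ≤ C * (a : ℝ) ^ (1 + δ) * ((UniqueFactorizationMonoid.radical (b * c) : ℕ) : ℝ) ^ (1 + δ) :=
        mul_le_mul_of_nonneg_right (mul_le_mul_of_nonneg_left hapow hC.le) hRpow
    _ = C * ((a : ℝ) * ((UniqueFactorizationMonoid.radical (b * c) : ℕ) : ℝ)) ^ (1 + δ) := by
        rw [mul_assoc, hmul]
    _ < C * ((a : ℝ) * ((UniqueFactorizationMonoid.radical (b * c) : ℕ) : ℝ)) ^ (1 + δ) +
          ((a : ℝ) * ((UniqueFactorizationMonoid.radical (b * c) : ℕ) : ℝ)) ^ (1 + δ) :=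
        lt_add_of_pos_right _ hpos
    _ = (C + 1) * ((a : ℝ) * ((UniqueFactorizationMonoid.radical (b * c) : ℕ) : ℝ)) ^ (1 + δ) := by
        ring

end Summit.ABC.ABC.Theorems.DepthCountedABC
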